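/-
Copyright (c) 2026 the pub-hodgecm-mathlib formalisation cell (harness21).  Prover seat hodgecm-mathlib-R90-CS-p03 (g3), R90-TF section S8 «ContSpec-n½» (dealer R90-CS-plan (g3), deal (4)
«CS-p03 imports K2E1-p13's constants file»): the `hsrc` row OF RECORD at the moved base point — ★ HEAD-B (`hsrc_at_basePoint_of_letters`, p864743) with the archimedean reading
DISCHARGED by ★ K2E1-p13 (g6) `archSectionShifted_midBlock_bigCell_eq_prod` (p864717) and the Haar constant NAMED `unfoldingHaarConst` (★ p864662).
-/
import Summits.HodgeConjecture.HodgeConjecture.Theorems.K2E1ChiMidBlockUnfoldingAtBasePointU3     -- ★ p864589∕p864743 (this seat): §1 `middleCoefficient_basePoint_eq_integral`, §3 `flatSectionU_archFin_bigCell_mul_finAdelicToAdelic`, HEAD-B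
import Summits.HodgeConjecture.HodgeConjecture.Theorems.K2E1ChiUnfoldingArchPhaseOfRecordU3      -- ★ p864717 (K2E1-p13 (g6)): `archSectionShifted_midBlock_bigCell_eq_prod`; brings ★ p864662 `unfoldingHaarConst`, `unfoldingHaarConst_spec`, `unfoldingArchPhase`
import Summits.HodgeConjecture.HodgeConjecture.Theorems.K2E1ChiIntertwinedCoeffKMaxCMThree        -- ED. 2: ★ `integrable_flatSectionU_weylLongU_mul` (Godement majorant: `hT`), brings ★ `integrable_borelHeight_weylLongU_mul_rpow_cm_three`, ★ Iwasawa
import Summits.HodgeConjecture.HodgeConjecture.Theorems.K2E1ChiFiniteWitnessIntegrableU3         -- ED. 2: ★ p864772 (F0P2-p11 (g4)): `integrable_finiteWitness_of_height_integrable`, `aestronglyMeasurable_weight_of_continuous` (`hfin`)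
import Summits.HodgeConjecture.HodgeConjecture.Theorems.R90S8ChiSectionPairNormBoundU3           -- ED. 2: ★ `norm_archSectionE_le_one` (`hΦM`)
import HarnessLib

/-!
# K2·E1 ∕ R90·S8 — `K2E1ChiMidBlockUnfoldingOfRecordU3`: THE `hsrc` ROW OF RECORD AT THE MOVED BASE POINT — CONSTANTS OF RECORD BOUND (`C := unfoldingHaarConst`, `ε := unfoldingArchPhase ξ`)

Cell `pub/hodgecm-mathlib`, crux h413 = `stmt-HodgeConjecture-24833`, route of record `HCCMUnconditional`; R90-TF section S8 «ContSpec-n½», road R2-χ₃ ((V)∕(R)′ OF RECORD rows `hsrc`, `hA32`).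
THEOREMS ONLY (no `def`, no `instance`, no notation, no named-fact hypothesis, no `sorry`; default heartbeats); lane `--supports stmt-HodgeConjecture-24833 --as helper` (count-neutral).

THE MATHEMATICS ([MoeglinWaldspurger1995] II.1.7, IV.1.11; [Rogawski1990] §13.9 p. 229).  ★ HEAD-B unfolds the middle coefficient `ψ_z(ι_f b₁)` of `E(φ_z)` for a section of record
`φ(g) = Φ_∞(g_∞)·Φ_f(g_f)` into `((C·∏_{v∈S₀} m_v(z))·∫∫ A_∞)·c_S(z)` modulo the arch reading `harch` of `Φ_∞` on the big cell, the pure-tensor reading `hΩ` of `Φ_f`, integrability and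
tokens, with `∃ C > 0`.  For K2E1-p13's SHIFTED WITNESS `Φ_∞ = archSectionShifted (ξ.bcη⁻¹·ξ.bcψ⁻¹·μω) ξ.ψ p q` (`μω` of unitary type `(kμ, 0)`) the arch reading is ★
`archSectionShifted_midBlock_bigCell_eq_prod` at `ε := unfoldingArchPhase ξ`, `m_w := kμ_w − 2·eη_w` (UNCONDITIONAL), and the constant is ★ (a-2b)'s at the name `unfoldingHaarConst`
(★ `unfoldingHaarConst_spec` = (a-2b)'s `∀`-body at that `C`).  So (HEAD) `∀ z, 2 < Re z → ψ_z(ι_f b₁) = A(z)·c_S(z)` with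
`A z = (↑(unfoldingHaarConst …)·∏_{v∈S₀} ν(𝒪³)⁻¹•∫𝟙_{B_v(𝔫)}·Q_v^{−z})·∫∫(∏_w unfoldingArchPhase ξ w·archUnitaryValue (kμ_w − 2eη_w) 0 ζ_w·((2+ζ_w)∕ζ_w)^{p_w}·((2+conj ζ_w)∕conj ζ_w)^{q_w})·ARCH₃^{−z}`
— ★ p864366's amplitude `fun z => …` body at `ε := unfoldingArchPhase L ξ`, `m := kμ − 2·ξ.eη`, `C := ↑(unfoldingHaarConst …)` BYTE FOR BYTE (so (V)'s `hA32` is ★ p864366∕p864422 with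
★ `unfoldingArchPhase_norm_le_one`, `unfoldingArchPhase_ne_zero`, `ofReal_unfoldingHaarConst_ne_zero`) — and `c_S` = ★ F5's ratio (`S = {w | w ∩ L⁺ ∈ S₀}`, `T′ = S₀`).
REMAINING LETTERS (named payers): section facts `hΦ hΦc hΦM hEis` (★ for the witness), `hgood` (★ `hgood_unfoldingBadPlaces` at `S₀` of record), `hωc hω1 hωS₀`, the L core `hΩ`
(K2E1-p14 (3)(ii) + K2E1-p11 (3)(iii) + ★ (E-supp)), `hT` (Godement majorant), `hfin` (F0P2-p11 (g4) `integrable_finiteWitness_of_spherical`), tokens `hin hsp` (C10-p07), and the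
(a-2b) character tokens `hφ hψ hres` — now VISIBLE because the named constant takes them — each ★ BY NAME: `isUnitary_bcηInv_mul` (R90.S8), §1 `isUnitary_quadraticHeckeCharCM_mul_self`,
§1 `bcηInv_mul_ideleBaseChange_eq` (from socket (V)'s `hμω`).
HONEST LABEL: HC_CM is proved only modulo the 7 printed citations (2 remaining named inputs: hLiu418 = `stmt-HodgeConjecture-24832`, h413 = `stmt-HodgeConjecture-24833`) until rung 0
closes; REL ≠ ★ ≠ BUILT; this file asserts no named fact and closes no socket; `hsrc` = HEAD modulo the letters just listed; count-neutral.

## References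
* [MoeglinWaldspurger1995] C. Mœglin, J.-L. Waldspurger, *Spectral Decomposition and Eisenstein Series* (1995): II.1.7, IV.1.11.
* [Rogawski1990] J. D. Rogawski, *Automorphic Representations of Unitary Groups in Three Variables*, Ann. of Math. Stud. 123 (1990): §12.2 p. 174, §13.9 p. 229.
* [TateThesis1967] J. Tate, *Fourier analysis in number fields and Hecke's zeta-functions* (1967): Thm 3.3.1.
* [Langlands1976] R. P. Langlands, *On the Functional Equations Satisfied by Eisenstein Series*, LNM 544 (1976): Appendix.
-/

set_option autoImplicit false
set_option linter.dupNamespace false -- the mandated namespace repeats `HodgeConjecture.HodgeConjecture`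

noncomputable section

open MeasureTheory MeasureTheory.Measure NumberField NumberField.InfinitePlace IsDedekindDomain Filter
open scoped NNReal ENNReal ComplexConjugate
open Literature.NumberTheory.Automorphic Literature.NumberTheory.Automorphic.UnitaryGroup Literature.NumberTheory.GaloisRepresentations AdelicGroupData
open Literature.NumberTheory.GaloisRepresentations.IsNonarchimedeanLocalField Literature.NumberTheory.LFunctions
open Literature.NumberTheory.Automorphic.Arthur2013.Leaves.TECR
open Literature.NumberTheory.Rogawski1990 (OneDimAutRepH)
open Summit.HodgeConjecture.HodgeConjecture.Cruxes.H413
open Summit.HodgeConjecture.HodgeConjecture.Cruxes.H413.K2E1BorelEisensteinU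
open Summit.HodgeConjecture.HodgeConjecture.Cruxes.H413.K2E1CharacterEisensteinU3PairDefs
open Summit.HodgeConjecture.HodgeConjecture.Cruxes.H413.K2E1ChiMidBlockUnfoldingAtBasePointU3 (middleCoefficient_basePoint_eq_integral flatSectionU_archFin_bigCell_mul_finAdelicToAdelic)
open Summit.HodgeConjecture.HodgeConjecture.Cruxes.H413.K2E1ChiUnfoldingConstantsOfRecordU3 (unfoldingHaarConst unfoldingHaarConst_spec unfoldingArchPhase)
open Summit.HodgeConjecture.HodgeConjecture.Cruxes.H413.K2E1ChiUnfoldingArchPhaseOfRecordU3 (archSectionShifted_midBlock_bigCell_eq_prod)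
open Summit.HodgeConjecture.HodgeConjecture.R90.S8
open Summit.HodgeConjecture.HodgeConjecture.Cruxes.H413.K2E1ChiIntertwinedCoeffKMaxCMThree (integrable_flatSectionU_weylLongU_mul)
open Summit.HodgeConjecture.HodgeConjecture.Cruxes.H413.K2E1IntertwinedCoeffContinuousCM (integrable_borelHeight_weylLongU_mul_rpow_cm_three)
open Summit.HodgeConjecture.HodgeConjecture.Cruxes.H413.K2E1HeisenbergHaarU3 (isInvInvariant_of_isHaarMeasure_adelicUnipotent_three)
open Summit.HodgeConjecture.HodgeConjecture.Cruxes.H413.K2E1ChiFiniteWitnessIntegrableU3 (integrable_finiteWitness_of_height_integrable aestronglyMeasurable_weight_of_continuous)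

namespace Summit.HodgeConjecture.HodgeConjecture.Cruxes.H413.K2E1ChiMidBlockUnfoldingOfRecordU3

variable (L : Type) [Field L] [NumberField L] [IsCMField L] (hc : IsCMField.complexConj L * IsCMField.complexConj L = 1)
  {δ : L} (hcδ : IsCMField.complexConj L δ = -δ) (hδ : δ ≠ 0)

/-! ## §1 The (a-2b) character tokens of record, by name -/

/-- **`ε_{L∕L⁺}·ε_{L∕L⁺}` is unitary** (it is `1`: ★ `quadraticHeckeCharCM_sq`) — ★ (a-2b)'s token `hψ` at `ψ := ε_{L∕L⁺}`. [cite: Rogawski1990, §12.2 p. 174] -/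
theorem isUnitary_quadraticHeckeCharCM_mul_self : (quadraticHeckeCharCM L * quadraticHeckeCharCM L).IsUnitary := by
  rw [← sq, quadraticHeckeCharCM_sq L]
  exact HeckeCharacter.isUnitary_one

/-- **`(ξ.bcη⁻¹·μω)|_{𝔸_{L⁺}^×} = ε_{L∕L⁺}`** when `μω|_{𝔸_{L⁺}^×} = ε_{L∕L⁺}` (socket (V)'s `hμω`; `bcη` is trivial on `𝔸_{L⁺}^×`, ★ `bcη_ideleBaseChange`) — ★ (a-2b)'s token `hres`.
[cite: Rogawski1990, §12.2 p. 174] -/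
theorem bcηInv_mul_ideleBaseChange_eq (ξ : OneDimAutRepH L) {μω : HeckeCharacter L}
    (hμω : ∀ x : ideleGroup ↥(maximalRealSubfield L), μω (AdeleRing.ideleBaseChange (↥(maximalRealSubfield L)) L x) = quadraticHeckeCharCM L x) :
    ∀ x : ideleGroup ↥(maximalRealSubfield L), (ξ.bcη⁻¹ * μω) (AdeleRing.ideleBaseChange (↥(maximalRealSubfield L)) L x) = quadraticHeckeCharCM L x := fun x => by
  rw [HeckeCharacter.mul_apply, HeckeCharacter.inv_apply, OneDimAutRepH.bcη_ideleBaseChange, inv_one, one_mul, hμω x]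

/-! ## §2 HEAD: the `hsrc` row of record at the moved base point -/

include hc in
/-- **HEAD — `hsrc` OF RECORD AT THE MOVED BASE POINT `ι_f(b₁)`, CONSTANTS OF RECORD BOUND.**  For the block `(ξ, μω)` (`μω` of unitary type `(kμ, 0)`), the (a-2b) character tokens
`hφ hψ hres` (★ by name), shifts `(p, q)`, a finite section `Φ_f` with the shifted section of record `φ(g) = archSectionShifted(…)(g_∞)·Φ_f(g_f)` a continuous bounded pair section (`hΦ hΦc hΦM`)
and its Eisenstein family `hEis`, a base point `ι_f(b₁) ∈ K_max`, a bad finset `S₀` (`hgood`), a level `𝔫`, weights `ω` (`hωc hω1`, `hωS₀ : ω_v = 𝟙_{B_v(𝔫)}` on `S₀`), the pure-tensor reading `hΩ`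
of `Φ_f` (the L core), integrability `hT hfin` and the good-place tokens `hin hsp`: for every `z` with `2 < Re z`,
`ψ_z(ι_f b₁) = ((↑(unfoldingHaarConst …)·∏_{v∈S₀} ν(𝒪³)⁻¹•∫𝟙_{B_v(𝔫)}·Q_v^{−z})·∫∫(∏_w unfoldingArchPhase ξ w·archUnitaryValue (kμ_w−2eη_w) 0 ζ_w·((2+ζ_w)∕ζ_w)^{p_w}((2+conj ζ_w)∕conj ζ_w)^{q_w})·ARCH₃^{−z})·c_S(z)`
— ★ p864366's amplitude at `(ε, m, C)` OF RECORD byte for byte, `c_S` = ★ F5's ratio.  Proof: ★ `unfoldingHaarConst_spec` (= ★ (a-2b) at the named `C`) at `A_∞ :=` the named integrand,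
`Ω(X_f,s_f) := Φ_f((ι(w₀)·u((0,X_f),θ(0,s_f)))_f·b₁)`, `hfac` := ★ `flatSectionU_archFin_bigCell_mul_finAdelicToAdelic` + ★ `archSectionShifted_midBlock_bigCell_eq_prod`; ★ §1
`middleCoefficient_basePoint_eq_integral`; `hωS₀` on the `S₀`-product; `ε² = 1`. [cite: MoeglinWaldspurger1995, II.1.7, IV.1.11] [cite: Rogawski1990, §13.9 p. 229] [cite: TateThesis1967, Thm 3.3.1] -/
theorem hsrc_of_record_at_basePoint {d : ↥(maximalRealSubfield L)} (hd : δ * δ = algebraMap ↥(maximalRealSubfield L) L d)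
    [MeasurableSpace (quasiSplit (↥(maximalRealSubfield L)) L (IsCMField.complexConj L) 3).Adelic] [BorelSpace (quasiSplit (↥(maximalRealSubfield L)) L (IsCMField.complexConj L) 3).Adelic]
    [MeasurableSpace (AdeleRing (𝓞 L) L)] [BorelSpace (AdeleRing (𝓞 L) L)]
    [MeasurableSpace (AdeleRing (𝓞 ↥(maximalRealSubfield L)) ↥(maximalRealSubfield L))] [BorelSpace (AdeleRing (𝓞 ↥(maximalRealSubfield L)) ↥(maximalRealSubfield L))]
    [MeasurableSpace (InfiniteAdeleRing L)] [BorelSpace (InfiniteAdeleRing L)]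
    [MeasurableSpace (InfiniteAdeleRing ↥(maximalRealSubfield L))] [BorelSpace (InfiniteAdeleRing ↥(maximalRealSubfield L))]
    [MeasurableSpace (FiniteAdeleRing (𝓞 L) L)] [BorelSpace (FiniteAdeleRing (𝓞 L) L)]
    [MeasurableSpace (FiniteAdeleRing (𝓞 ↥(maximalRealSubfield L)) ↥(maximalRealSubfield L))] [BorelSpace (FiniteAdeleRing (𝓞 ↥(maximalRealSubfield L)) ↥(maximalRealSubfield L))]
    [∀ v : HeightOneSpectrum (𝓞 ↥(maximalRealSubfield L)), MeasurableSpace (v.adicCompletion ↥(maximalRealSubfield L))] [∀ v : HeightOneSpectrum (𝓞 ↥(maximalRealSubfield L)), BorelSpace (v.adicCompletion ↥(maximalRealSubfield L))]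
    (ν : Measure ↥(adelicUnipotent ↥(maximalRealSubfield L) L (IsCMField.complexConj L) 3)) [ν.IsHaarMeasure]
    {𝓕 : Set ↥(adelicUnipotent ↥(maximalRealSubfield L) L (IsCMField.complexConj L) 3)} (h𝓕 : IsFundamentalDomain ↥(rationalUnipotent ↥(maximalRealSubfield L) L (IsCMField.complexConj L) 3) 𝓕 ν)
    (μE : Measure (AdeleRing (𝓞 L) L)) [μE.IsAddHaarMeasure] (μE₁ : Measure (InfiniteAdeleRing L)) [μE₁.IsAddHaarMeasure]
    (μE₂ : Measure (FiniteAdeleRing (𝓞 L) L)) [μE₂.IsAddHaarMeasure]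
    (μF : Measure (AdeleRing (𝓞 ↥(maximalRealSubfield L)) ↥(maximalRealSubfield L))) [μF.IsAddHaarMeasure] (μF₁ : Measure (InfiniteAdeleRing ↥(maximalRealSubfield L))) [μF₁.IsAddHaarMeasure]
    (μF₂ : Measure (FiniteAdeleRing (𝓞 ↥(maximalRealSubfield L)) ↥(maximalRealSubfield L))) [μF₂.IsAddHaarMeasure]
    (νv : ∀ v : HeightOneSpectrum (𝓞 ↥(maximalRealSubfield L)), Measure (v.adicCompletion ↥(maximalRealSubfield L))) [∀ v, (νv v).IsAddHaarMeasure]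
    (h𝓕c : IsCompact (closure 𝓕)) (h𝓕1 : ν 𝓕 = 1)
    -- the block of record `(ξ, μω)` of unitary type `(kμ, 0)`, the (a-2b) character tokens (★ by name: `isUnitary_bcηInv_mul`, §1), the shifts `(p, q)`
    (ξ : OneDimAutRepH L) {μω : HeckeCharacter L} {kμ : InfinitePlace L → ℤ} (hμ : μω.HasUnitaryArchType kμ 0)
    (hφ : (ξ.bcη⁻¹ * μω).IsUnitary) (hψ : (quadraticHeckeCharCM L * quadraticHeckeCharCM L).IsUnitary)
    (hres : ∀ x : ideleGroup ↥(maximalRealSubfield L), (ξ.bcη⁻¹ * μω) (AdeleRing.ideleBaseChange (↥(maximalRealSubfield L)) L x) = quadraticHeckeCharCM L x)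
    (p q : InfinitePlace L → ℕ) (Φf : ↥(finAdelic (↥(maximalRealSubfield L)) L (IsCMField.complexConj L) 3 ((StdForm.antidiagonal 3).over L)) → ℂ)
    (hΦ : IsChiSectionPair (ξ.bcη⁻¹ * ξ.bcψ⁻¹ * μω) ξ.ψ (fun g : (quasiSplit (↥(maximalRealSubfield L)) L (IsCMField.complexConj L) 3).Adelic => archSectionShifted L (ξ.bcη⁻¹ * ξ.bcψ⁻¹ * μω) ξ.ψ p q (archPart (↥(maximalRealSubfield L)) L (IsCMField.complexConj L) 3 ((StdForm.antidiagonal 3).over L) g) * Φf (finPart (↥(maximalRealSubfield L)) L (IsCMField.complexConj L) 3 ((StdForm.antidiagonal 3).over L) g))) (hΦc : Continuous (fun g : (quasiSplit (↥(maximalRealSubfield L)) L (IsCMField.complexConj L) 3).Adelic => archSectionShifted L (ξ.bcη⁻¹ * ξ.bcψ⁻¹ * μω) ξ.ψ p q (archPart (↥(maximalRealSubfield L)) L (IsCMField.complexConj L) 3 ((StdForm.antidiagonal 3).over L) g) * Φf (finPart (↥(maximalRealSubfield L)) L (IsCMField.complexConj L) 3 ((StdForm.antidiagonal 3).over L) 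g)))
    {MΦ : ℝ} (hΦM : ∀ x : (quasiSplit (↥(maximalRealSubfield L)) L (IsCMField.complexConj L) 3).Adelic, ‖archSectionShifted L (ξ.bcη⁻¹ * ξ.bcψ⁻¹ * μω) ξ.ψ p q (archPart (↥(maximalRealSubfield L)) L (IsCMField.complexConj L) 3 ((StdForm.antidiagonal 3).over L) x) * Φf (finPart (↥(maximalRealSubfield L)) L (IsCMField.complexConj L) 3 ((StdForm.antidiagonal 3).over L) x)‖ ≤ MΦ)
    (Ec : ℂ → (quasiSplit (↥(maximalRealSubfield L)) L (IsCMField.complexConj L) 3).Adelic → ℂ) (hEis : ∀ z : ℂ, 2 < z.re → Ec z = eisensteinSeriesU (flatSectionU (fun g : (quasiSplit (↥(maximalRealSubfield L)) L (IsCMField.complexConj L) 3).Adelic => archSectionShifted L (ξ.bcη⁻¹ * ξ.bcψ⁻¹ * μω) ξ.ψ p q (archPart (↥(maximalRealSubfield L)) L (IsCMField.complexConj L) 3 ((StdForm.antidiagonal 3).over L) g) * Φf (finPart (↥(maximalRealSubfield L)) L (IsCMField.complexConj L) 3 ((StdForm.antidiagonal 3).over L) g)) z))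
    {b₁ : ↥(finAdelic (↥(maximalRealSubfield L)) L (IsCMField.complexConj L) 3 ((StdForm.antidiagonal 3).over L))} (hb₁ : finAdelicToAdelic (↥(maximalRealSubfield L)) L (IsCMField.complexConj L) 3 ((StdForm.antidiagonal 3).over L) b₁ ∈ ((standardMaximalCompactGL 3 L).comap (adelicVal (↥(maximalRealSubfield L)) L (IsCMField.complexConj L) 3 ((StdForm.antidiagonal 3).over L)) : Subgroup (quasiSplit (↥(maximalRealSubfield L)) L (IsCMField.complexConj L) 3).Adelic))
    (S₀ : Finset (HeightOneSpectrum (𝓞 ↥(maximalRealSubfield L))))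
    (hgood : ∀ v ∉ S₀, (Algebra.IsUnramifiedIn (𝓞 L) v.asIdeal ∧ Valued.v (2 : v.adicCompletion ↥(maximalRealSubfield L)) = 1 ∧
        ∀ w : PlacesOver L v, Valued.v (algebraMap L (LocalRing L v) δ w) = 1) ∧ ∀ w : PlacesOver L v, (ξ.bcη⁻¹ * μω).IsUnramifiedAt w.1)
    (𝔫 : Ideal (𝓞 L))
    (ω : ∀ v : HeightOneSpectrum (𝓞 ↥(maximalRealSubfield L)), (Fin 3 → v.adicCompletion ↥(maximalRealSubfield L)) → ℂ)
    (hωc : ∀ z : ℂ, 2 < z.re → ∀ v, Continuous fun p : Fin 3 → v.adicCompletion ↥(maximalRealSubfield L) =>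
        ω v p * (((∏ w' : PlacesOver L v, max 1 (max ((normAbs (w'.1.adicCompletion L) (quadraticLocalEquiv L v (IsCMField.complexConj L) hcδ hδ (p 0, p 1) w') : ℝ≥0) : ℝ)
            ((normAbs (w'.1.adicCompletion L) ((toLocalRing L v (p 2) * algebraMap L (LocalRing L v) δ -
              toLocalRing L v 2⁻¹ * (quadraticLocalEquiv L v (IsCMField.complexConj L) hcδ hδ (p 0, p 1) *
                conjLocal L (IsCMField.complexConj L) v (quadraticLocalEquiv L v (IsCMField.complexConj L) hcδ hδ (p 0, p 1)))) w') : ℝ≥0) : ℝ))) : ℝ) : ℂ) ^ (-z))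
    (hω1 : ∀ v ∉ S₀, ∀ p ∈ integralBox ↥(maximalRealSubfield L) (Fin 3) v, ω v p = 1)
    (hωS₀ : ∀ v ∈ S₀, ω v = Set.indicator {p : Fin 3 → v.adicCompletion ↥(maximalRealSubfield L) | p ∈ integralBox ↥(maximalRealSubfield L) (Fin 3) v ∧ ∀ w' : PlacesOver L v,
              Valued.v (quadraticLocalEquiv L v (IsCMField.complexConj L) hcδ hδ (p 0, p 1) w') ≤ idealRadius L w'.1 𝔫 ∧
              Valued.v (conjLocal L (IsCMField.complexConj L) v (quadraticLocalEquiv L v (IsCMField.complexConj L) hcδ hδ (p 0, p 1)) w') ≤ idealRadius L w'.1 𝔫 ∧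
              Valued.v ((toLocalRing L v (p 2) * algebraMap L (LocalRing L v) δ -
                toLocalRing L v 2⁻¹ * (quadraticLocalEquiv L v (IsCMField.complexConj L) hcδ hδ (p 0, p 1) * conjLocal L (IsCMField.complexConj L) v (quadraticLocalEquiv L v (IsCMField.complexConj L) hcδ hδ (p 0, p 1)))) w') ≤ idealRadius L w'.1 𝔫}
            (fun _ => (1 : ℂ)))
    (hΩ : ∀ x : Fin 3 → FiniteAdeleRing (𝓞 ↥(maximalRealSubfield L)) ↥(maximalRealSubfield L),
      Φf (finPart (↥(maximalRealSubfield L)) L (IsCMField.complexConj L) 3 ((StdForm.antidiagonal 3).over L) ((quasiSplit (↥(maximalRealSubfield L)) L (IsCMField.complexConj L) 3).toAdelic (weylLongU ((IsCMField.complexConj L : L ≃ₐ[↥(maximalRealSubfield L)] L) : L →+* L) (rfl : (StdForm.antidiagonal 3).over L = (StdForm.antidiagonal 3).over L)) * (((heisChart hc (((((0 : InfiniteAdeleRing L)), quadraticFiniteAdeleMap ↥(maximalRealSubfield L) L δ (x 0, x 1)) : AdeleRing (𝓞 L) L), traceZeroLine ↥(maximalRealSubfield L) L (IsCMField.complexConj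 L) hcδ hδ ((0, x 2) : AdeleRing (𝓞 ↥(maximalRealSubfield L)) ↥(maximalRealSubfield L)))) : ↥(adelicUnipotent ↥(maximalRealSubfield L) L (IsCMField.complexConj L) 3)) : (quasiSplit (↥(maximalRealSubfield L)) L (IsCMField.complexConj L) 3).Adelic)) * b₁) = ∏ᶠ v : HeightOneSpectrum (𝓞 ↥(maximalRealSubfield L)), ω v (fun i => x i v))
    (hT : ∀ z : ℂ, 2 < z.re → Integrable (fun v : ↥(adelicUnipotent ↥(maximalRealSubfield L) L (IsCMField.complexConj L) 3) => flatSectionU (fun g : (quasiSplit (↥(maximalRealSubfield L)) L (IsCMField.complexConj L) 3).Adelic => archSectionShifted L (ξ.bcη⁻¹ * ξ.bcψ⁻¹ * μω) ξ.ψ p q (archPart (↥(maximalRealSubfield L)) L (IsCMField.complexConj L) 3 ((StdForm.antidiagonal 3).over L) g) * Φf (finPart (↥(maximalRealSubfield L)) L (IsCMField.complexConj L) 3 ((StdForm.antidiagonal 3).over L) g)) z ((quasiSplit (↥(maximalRealSubfield L)) L (IsCMField.complexConj L) 3).toAdelic (weylLongU ((IsCMField.complexConj L : L ≃ₐ[↥(maximalRealSubfield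 L)] L) : L →+* L) (rfl : (StdForm.antidiagonal 3).over L = (StdForm.antidiagonal 3).over L)) * ((v : (quasiSplit (↥(maximalRealSubfield L)) L (IsCMField.complexConj L) 3).Adelic) * finAdelicToAdelic (↥(maximalRealSubfield L)) L (IsCMField.complexConj L) 3 ((StdForm.antidiagonal 3).over L) b₁))) ν)
    (hfin : ∀ z : ℂ, 2 < z.re → Integrable (fun q : FiniteAdeleRing (𝓞 L) L × FiniteAdeleRing (𝓞 ↥(maximalRealSubfield L)) ↥(maximalRealSubfield L) =>
      (Φf (finPart (↥(maximalRealSubfield L)) L (IsCMField.complexConj L) 3 ((StdForm.antidiagonal 3).over L) ((quasiSplit (↥(maximalRealSubfield L)) L (IsCMField.complexConj L) 3).toAdelic (weylLongU ((IsCMField.complexConj L : L ≃ₐ[↥(maximalRealSubfield L)] L) : L →+* L) (rfl : (StdForm.antidiagonal 3).over L = (StdForm.antidiagonal 3).over L)) * (((heisChart hc (((((0 : InfiniteAdeleRing L)), q.1) : AdeleRing (𝓞 L) L), traceZeroLine ↥(maximalRealSubfield L) L (IsCMField.complexConj L) hcδ hδ ((0, q.2) : AdeleRing (𝓞 ↥(maximalRealSubfield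 L)) ↥(maximalRealSubfield L)))) : ↥(adelicUnipotent ↥(maximalRealSubfield L) L (IsCMField.complexConj L) 3)) : (quasiSplit (↥(maximalRealSubfield L)) L (IsCMField.complexConj L) 3).Adelic)) * b₁) * ((((∏ᶠ w : HeightOneSpectrum (𝓞 L), max 1 (max ‖((((0 : InfiniteAdeleRing L)), q.1) : AdeleRing (𝓞 L) L).2 w‖₊ ‖(heisZ (c := IsCMField.complexConj L) ((((0 : InfiniteAdeleRing L)), q.1) : AdeleRing (𝓞 L) L) ((traceZeroLine ↥(maximalRealSubfield L) L (IsCMField.complexConj L) hcδ hδ ((0, q.2) : AdeleRing (𝓞 ↥(maximalRealSubfield L)) ↥(maximalRealSubfield L)) : traceZeroAdele ↥(maximalRealSubfield L) L (IsCMField.complexConj L)) : AdeleRing (𝓞 L) L)).2 w‖₊) : ℝ≥0) : ℝ) : ℂ) ^ (-z)))) (μE₂.prod μF₂))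
    (hin : ∀ z : ℂ, 2 < z.re → ∀ v ∉ S₀, ∀ w : PlacesOver L v, IsCMField.complexConj L • w.1 = w.1 →
        ((Measure.pi fun _ : Fin 3 => νv v) (integralBox ↥(maximalRealSubfield L) (Fin 3) v)).toReal⁻¹ •
            ∫ p : Fin 3 → v.adicCompletion ↥(maximalRealSubfield L),
              ω v p * (((∏ w' : PlacesOver L v, max 1 (max ((normAbs (w'.1.adicCompletion L) (quadraticLocalEquiv L v (IsCMField.complexConj L) hcδ hδ (p 0, p 1) w') : ℝ≥0) : ℝ)
                ((normAbs (w'.1.adicCompletion L) ((toLocalRing L v (p 2) * algebraMap L (LocalRing L v) δ -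
                  toLocalRing L v 2⁻¹ * (quadraticLocalEquiv L v (IsCMField.complexConj L) hcδ hδ (p 0, p 1) *
                    conjLocal L (IsCMField.complexConj L) v (quadraticLocalEquiv L v (IsCMField.complexConj L) hcδ hδ (p 0, p 1)))) w') : ℝ≥0) : ℝ))) : ℝ) : ℂ) ^ (-z)
              ∂(Measure.pi fun _ : Fin 3 => νv v) =
          (1 - (ξ.bcη⁻¹ * μω).valueAtUniformizer w.1 * (v.residueCard : ℂ) ^ (-(2 * z))) * (1 + (ξ.bcη⁻¹ * μω).valueAtUniformizer w.1 * (v.residueCard : ℂ) ^ (-(2 * z - 1))) /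
            ((1 - (ξ.bcη⁻¹ * μω).valueAtUniformizer w.1 * (v.residueCard : ℂ) ^ (-(2 * z - 2))) * (1 + (ξ.bcη⁻¹ * μω).valueAtUniformizer w.1 * (v.residueCard : ℂ) ^ (-(2 * z - 2)))))
    (hsp : ∀ z : ℂ, 2 < z.re → ∀ v ∉ S₀, ∀ w : PlacesOver L v, IsCMField.complexConj L • w.1 ≠ w.1 →
        ((Measure.pi fun _ : Fin 3 => νv v) (integralBox ↥(maximalRealSubfield L) (Fin 3) v)).toReal⁻¹ •
            ∫ p : Fin 3 → v.adicCompletion ↥(maximalRealSubfield L),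
              ω v p * (((∏ w' : PlacesOver L v, max 1 (max ((normAbs (w'.1.adicCompletion L) (quadraticLocalEquiv L v (IsCMField.complexConj L) hcδ hδ (p 0, p 1) w') : ℝ≥0) : ℝ)
                ((normAbs (w'.1.adicCompletion L) ((toLocalRing L v (p 2) * algebraMap L (LocalRing L v) δ -
                  toLocalRing L v 2⁻¹ * (quadraticLocalEquiv L v (IsCMField.complexConj L) hcδ hδ (p 0, p 1) *
                    conjLocal L (IsCMField.complexConj L) v (quadraticLocalEquiv L v (IsCMField.complexConj L) hcδ hδ (p 0, p 1)))) w') : ℝ≥0) : ℝ))) : ℝ) : ℂ) ^ (-z)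
              ∂(Measure.pi fun _ : Fin 3 => νv v) =
          (1 - (ξ.bcη⁻¹ * μω).valueAtUniformizer w.1 * (v.residueCard : ℂ) ^ (-z)) * (1 - (ξ.bcη⁻¹ * μω).valueAtUniformizer (PlacesOver.galInv (IsCMField.complexConj L) w).1 * (v.residueCard : ℂ) ^ (-z)) *
              (1 - (ξ.bcη⁻¹ * μω).valueAtUniformizer w.1 * (ξ.bcη⁻¹ * μω).valueAtUniformizer (PlacesOver.galInv (IsCMField.complexConj L) w).1 * (v.residueCard : ℂ) ^ (-(2 * z - 1))) /
            ((1 - (ξ.bcη⁻¹ * μω).valueAtUniformizer w.1 * (v.residueCard : ℂ) ^ (-(z - 1))) * (1 - (ξ.bcη⁻¹ * μω).valueAtUniformizer (PlacesOver.galInv (IsCMField.complexConj L) w).1 * (v.residueCard : ℂ) ^ (-(z - 1))) *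
              (1 - (ξ.bcη⁻¹ * μω).valueAtUniformizer w.1 * (ξ.bcη⁻¹ * μω).valueAtUniformizer (PlacesOver.galInv (IsCMField.complexConj L) w).1 * (v.residueCard : ℂ) ^ (-(2 * z - 2))))) :
    ∀ z : ℂ, 2 < z.re →
      (borelConstantTerm ν 𝓕 (Ec z) (finAdelicToAdelic (↥(maximalRealSubfield L)) L (IsCMField.complexConj L) 3 ((StdForm.antidiagonal 3).over L) b₁) - archSectionShifted L (ξ.bcη⁻¹ * ξ.bcψ⁻¹ * μω) ξ.ψ p q (archPart (↥(maximalRealSubfield L)) L (IsCMField.complexConj L) 3 ((StdForm.antidiagonal 3).over L) (finAdelicToAdelic (↥(maximalRealSubfield L)) L (IsCMField.complexConj L) 3 ((StdForm.antidiagonal 3).over L) b₁)) * Φf (finPart (↥(maximalRealSubfield L)) L (IsCMField.complexConj L) 3 ((StdForm.antidiagonal 3).over L) (finAdelicToAdelic (↥(maximalRealSubfield L)) L (IsCMField.complexConj L) 3 ((StdForm.antidiagonal 3).over L) b₁)) * (((borelHeight (finAdelicToAdelic (↥(maximalRealSubfield L)) L (IsCMField.complexConj L) 3 ((StdForm.antidiagonal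 3).over L) b₁) : ℝ≥0) : ℝ) : ℂ) ^ z) / (((borelHeight (finAdelicToAdelic (↥(maximalRealSubfield L)) L (IsCMField.complexConj L) 3 ((StdForm.antidiagonal 3).over L) b₁) : ℝ≥0) : ℝ) : ℂ) ^ (2 - z) =
        (((unfoldingHaarConst L hc hcδ hδ hd ν h𝓕 μE μE₁ μE₂ μF μF₁ μF₂ νv hφ hψ hres : ℝ) : ℂ) * ∏ v ∈ S₀, ((Measure.pi fun _ : Fin 3 => νv v) (integralBox ↥(maximalRealSubfield L) (Fin 3) v)).toReal⁻¹ •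
        ∫ p : Fin 3 → v.adicCompletion ↥(maximalRealSubfield L),
                    Set.indicator {p : Fin 3 → v.adicCompletion ↥(maximalRealSubfield L) | p ∈ integralBox ↥(maximalRealSubfield L) (Fin 3) v ∧ ∀ w' : PlacesOver L v,
              Valued.v (quadraticLocalEquiv L v (IsCMField.complexConj L) hcδ hδ (p 0, p 1) w') ≤ idealRadius L w'.1 𝔫 ∧
              Valued.v (conjLocal L (IsCMField.complexConj L) v (quadraticLocalEquiv L v (IsCMField.complexConj L) hcδ hδ (p 0, p 1)) w') ≤ idealRadius L w'.1 𝔫 ∧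
              Valued.v ((toLocalRing L v (p 2) * algebraMap L (LocalRing L v) δ -
                toLocalRing L v 2⁻¹ * (quadraticLocalEquiv L v (IsCMField.complexConj L) hcδ hδ (p 0, p 1) * conjLocal L (IsCMField.complexConj L) v (quadraticLocalEquiv L v (IsCMField.complexConj L) hcδ hδ (p 0, p 1)))) w') ≤ idealRadius L w'.1 𝔫}
            (fun _ => (1 : ℂ)) p *
          (((∏ w' : PlacesOver L v, max 1 (max ((normAbs (w'.1.adicCompletion L) (quadraticLocalEquiv L v (IsCMField.complexConj L) hcδ hδ (p 0, p 1) w') : ℝ≥0) : ℝ)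
            ((normAbs (w'.1.adicCompletion L) ((toLocalRing L v (p 2) * algebraMap L (LocalRing L v) δ -
              toLocalRing L v 2⁻¹ * (quadraticLocalEquiv L v (IsCMField.complexConj L) hcδ hδ (p 0, p 1) *
                conjLocal L (IsCMField.complexConj L) v (quadraticLocalEquiv L v (IsCMField.complexConj L) hcδ hδ (p 0, p 1)))) w') : ℝ≥0) : ℝ))) : ℝ) : ℂ) ^ (-z) ∂(Measure.pi fun _ : Fin 3 => νv v)) *
      (∫ Xi : InfiniteAdeleRing L, ∫ a : InfiniteAdeleRing ↥(maximalRealSubfield L),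
      (∏ w : InfinitePlace L, unfoldingArchPhase L ξ w * archUnitaryValue (kμ w - 2 * ξ.eη w) 0 ((((-(1 + ‖Xi w‖ ^ 2 / 2)) : ℝ) : ℂ) + (((w.embedding δ).im * ((InfiniteAdeleRing.ringEquiv_mixedSpace ↥(maximalRealSubfield L)) a).1 ⟨w.comap (algebraMap ↥(maximalRealSubfield L) L), K2E1HeightBigCellLineFormulaU2.isReal_comap_maximalRealSubfield L w⟩ : ℝ) : ℂ) * Complex.I) * (((2 : ℂ) + ((((-(1 + ‖Xi w‖ ^ 2 / 2)) : ℝ) : ℂ) + (((w.embedding δ).im * ((InfiniteAdeleRing.ringEquiv_mixedSpace ↥(maximalRealSubfield L)) a).1 ⟨w.comap (algebraMap ↥(maximalRealSubfield L) L), K2E1HeightBigCellLineFormulaU2.isReal_comap_maximalRealSubfield L w⟩ : ℝ) : ℂ) * Complex.I)) / ((((-(1 + ‖Xi w‖ ^ 2 / 2)) : ℝ) : ℂ) + (((w.embedding δ).im * ((InfiniteAdeleRing.ringEquiv_mixedSpace ↥(maximalRealSubfield L)) a).1 ⟨w.comap (algebraMap ↥(maximalRealSubfield L) L), K2E1HeightBigCellLineFormulaU2.isReal_comap_maximalRealSubfield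 L w⟩ : ℝ) : ℂ) * Complex.I)) ^ p w * (((2 : ℂ) + conj ((((-(1 + ‖Xi w‖ ^ 2 / 2)) : ℝ) : ℂ) + (((w.embedding δ).im * ((InfiniteAdeleRing.ringEquiv_mixedSpace ↥(maximalRealSubfield L)) a).1 ⟨w.comap (algebraMap ↥(maximalRealSubfield L) L), K2E1HeightBigCellLineFormulaU2.isReal_comap_maximalRealSubfield L w⟩ : ℝ) : ℂ) * Complex.I)) / conj ((((-(1 + ‖Xi w‖ ^ 2 / 2)) : ℝ) : ℂ) + (((w.embedding δ).im * ((InfiniteAdeleRing.ringEquiv_mixedSpace ↥(maximalRealSubfield L)) a).1 ⟨w.comap (algebraMap ↥(maximalRealSubfield L) L), K2E1HeightBigCellLineFormulaU2.isReal_comap_maximalRealSubfield L w⟩ : ℝ) : ℂ) * Complex.I)) ^ q w) *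
        ((((∏ w : InfinitePlace L, ((1 + ‖(Xi) w‖ ^ 2 / 2) ^ 2 + (w δ) ^ 2 * (((InfiniteAdeleRing.ringEquiv_mixedSpace ↥(maximalRealSubfield L)) a).1 ⟨w.comap (algebraMap ↥(maximalRealSubfield L) L), K2E1HeightBigCellLineFormulaU2.isReal_comap_maximalRealSubfield L w⟩) ^ 2))) : ℝ) : ℂ) ^ (-z) ∂μF₁ ∂μE₁) *
        ((partialStandardL {w : HeightOneSpectrum (𝓞 L) | w.under (𝓞 ↥(maximalRealSubfield L)) ∈ (↑S₀ : Set (HeightOneSpectrum (𝓞 ↥(maximalRealSubfield L))))} (fun w => {(ξ.bcη⁻¹ * μω).valueAtUniformizer w}) (z - 1) *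
            partialStandardL (↑S₀ : Set (HeightOneSpectrum (𝓞 ↥(maximalRealSubfield L)))) (fun v => {(1 : HeckeCharacter ↥(maximalRealSubfield L)).valueAtUniformizer v}) (2 * z - 2)) /
          (partialStandardL {w : HeightOneSpectrum (𝓞 L) | w.under (𝓞 ↥(maximalRealSubfield L)) ∈ (↑S₀ : Set (HeightOneSpectrum (𝓞 ↥(maximalRealSubfield L))))} (fun w => {(ξ.bcη⁻¹ * μω).valueAtUniformizer w}) z *
            partialStandardL (↑S₀ : Set (HeightOneSpectrum (𝓞 ↥(maximalRealSubfield L)))) (fun v => {(1 : HeckeCharacter ↥(maximalRealSubfield L)).valueAtUniformizer v}) (2 * z - 1)))  := by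
  intro z hz
  have hqq : quadraticHeckeCharCM L * quadraticHeckeCharCM L = 1 := by rw [← sq]; exact quadraticHeckeCharCM_sq L
  have hω' : ∀ v ∈ S₀, (((Measure.pi fun _ : Fin 3 => νv v) (integralBox ↥(maximalRealSubfield L) (Fin 3) v)).toReal⁻¹ •
        ∫ p : Fin 3 → v.adicCompletion ↥(maximalRealSubfield L),
          ω v p * (((∏ w' : PlacesOver L v, max 1 (max ((normAbs (w'.1.adicCompletion L) (quadraticLocalEquiv L v (IsCMField.complexConj L) hcδ hδ (p 0, p 1) w') : ℝ≥0) : ℝ)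
            ((normAbs (w'.1.adicCompletion L) ((toLocalRing L v (p 2) * algebraMap L (LocalRing L v) δ -
              toLocalRing L v 2⁻¹ * (quadraticLocalEquiv L v (IsCMField.complexConj L) hcδ hδ (p 0, p 1) *
                conjLocal L (IsCMField.complexConj L) v (quadraticLocalEquiv L v (IsCMField.complexConj L) hcδ hδ (p 0, p 1)))) w') : ℝ≥0) : ℝ))) : ℝ) : ℂ) ^ (-z) ∂(Measure.pi fun _ : Fin 3 => νv v)) =
      (((Measure.pi fun _ : Fin 3 => νv v) (integralBox ↥(maximalRealSubfield L) (Fin 3) v)).toReal⁻¹ •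
        ∫ p : Fin 3 → v.adicCompletion ↥(maximalRealSubfield L),
                    Set.indicator {p : Fin 3 → v.adicCompletion ↥(maximalRealSubfield L) | p ∈ integralBox ↥(maximalRealSubfield L) (Fin 3) v ∧ ∀ w' : PlacesOver L v,
              Valued.v (quadraticLocalEquiv L v (IsCMField.complexConj L) hcδ hδ (p 0, p 1) w') ≤ idealRadius L w'.1 𝔫 ∧
              Valued.v (conjLocal L (IsCMField.complexConj L) v (quadraticLocalEquiv L v (IsCMField.complexConj L) hcδ hδ (p 0, p 1)) w') ≤ idealRadius L w'.1 𝔫 ∧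
              Valued.v ((toLocalRing L v (p 2) * algebraMap L (LocalRing L v) δ -
                toLocalRing L v 2⁻¹ * (quadraticLocalEquiv L v (IsCMField.complexConj L) hcδ hδ (p 0, p 1) * conjLocal L (IsCMField.complexConj L) v (quadraticLocalEquiv L v (IsCMField.complexConj L) hcδ hδ (p 0, p 1)))) w') ≤ idealRadius L w'.1 𝔫}
            (fun _ => (1 : ℂ)) p *
          (((∏ w' : PlacesOver L v, max 1 (max ((normAbs (w'.1.adicCompletion L) (quadraticLocalEquiv L v (IsCMField.complexConj L) hcδ hδ (p 0, p 1) w') : ℝ≥0) : ℝ)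
            ((normAbs (w'.1.adicCompletion L) ((toLocalRing L v (p 2) * algebraMap L (LocalRing L v) δ -
              toLocalRing L v 2⁻¹ * (quadraticLocalEquiv L v (IsCMField.complexConj L) hcδ hδ (p 0, p 1) *
                conjLocal L (IsCMField.complexConj L) v (quadraticLocalEquiv L v (IsCMField.complexConj L) hcδ hδ (p 0, p 1)))) w') : ℝ≥0) : ℝ))) : ℝ) : ℂ) ^ (-z) ∂(Measure.pi fun _ : Fin 3 => νv v)) := fun v hv => by rw [hωS₀ v hv]
  have k := unfoldingHaarConst_spec L hc hcδ hδ hd ν h𝓕 μE μE₁ μE₂ μF μF₁ μF₂ νv hφ hψ hres S₀ hgood hz ω (hωc z hz) hω1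
    (fun (Xi : InfiniteAdeleRing L) (a : InfiniteAdeleRing ↥(maximalRealSubfield L)) =>
      (∏ w : InfinitePlace L, unfoldingArchPhase L ξ w * archUnitaryValue (kμ w - 2 * ξ.eη w) 0 ((((-(1 + ‖Xi w‖ ^ 2 / 2)) : ℝ) : ℂ) + (((w.embedding δ).im * ((InfiniteAdeleRing.ringEquiv_mixedSpace ↥(maximalRealSubfield L)) a).1 ⟨w.comap (algebraMap ↥(maximalRealSubfield L) L), K2E1HeightBigCellLineFormulaU2.isReal_comap_maximalRealSubfield L w⟩ : ℝ) : ℂ) * Complex.I) * (((2 : ℂ) + ((((-(1 + ‖Xi w‖ ^ 2 / 2)) : ℝ) : ℂ) + (((w.embedding δ).im * ((InfiniteAdeleRing.ringEquiv_mixedSpace ↥(maximalRealSubfield L)) a).1 ⟨w.comap (algebraMap ↥(maximalRealSubfield L) L), K2E1HeightBigCellLineFormulaU2.isReal_comap_maximalRealSubfield L w⟩ : ℝ) : ℂ) * Complex.I)) / ((((-(1 + ‖Xi w‖ ^ 2 / 2)) : ℝ) : ℂ) + (((w.embedding δ).im * ((InfiniteAdeleRing.ringEquiv_mixedSpace ↥(maximalRealSubfield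 L)) a).1 ⟨w.comap (algebraMap ↥(maximalRealSubfield L) L), K2E1HeightBigCellLineFormulaU2.isReal_comap_maximalRealSubfield L w⟩ : ℝ) : ℂ) * Complex.I)) ^ p w * (((2 : ℂ) + conj ((((-(1 + ‖Xi w‖ ^ 2 / 2)) : ℝ) : ℂ) + (((w.embedding δ).im * ((InfiniteAdeleRing.ringEquiv_mixedSpace ↥(maximalRealSubfield L)) a).1 ⟨w.comap (algebraMap ↥(maximalRealSubfield L) L), K2E1HeightBigCellLineFormulaU2.isReal_comap_maximalRealSubfield L w⟩ : ℝ) : ℂ) * Complex.I)) / conj ((((-(1 + ‖Xi w‖ ^ 2 / 2)) : ℝ) : ℂ) + (((w.embedding δ).im * ((InfiniteAdeleRing.ringEquiv_mixedSpace ↥(maximalRealSubfield L)) a).1 ⟨w.comap (algebraMap ↥(maximalRealSubfield L) L), K2E1HeightBigCellLineFormulaU2.isReal_comap_maximalRealSubfield L w⟩ : ℝ) : ℂ) * Complex.I)) ^ q w) *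
        ((((∏ w : InfinitePlace L, ((1 + ‖(Xi) w‖ ^ 2 / 2) ^ 2 + (w δ) ^ 2 * (((InfiniteAdeleRing.ringEquiv_mixedSpace ↥(maximalRealSubfield L)) a).1 ⟨w.comap (algebraMap ↥(maximalRealSubfield L) L), K2E1HeightBigCellLineFormulaU2.isReal_comap_maximalRealSubfield L w⟩) ^ 2))) : ℝ) : ℂ) ^ (-z))
    (fun (Xf : FiniteAdeleRing (𝓞 L) L) (sf : FiniteAdeleRing (𝓞 ↥(maximalRealSubfield L)) ↥(maximalRealSubfield L)) => Φf (finPart (↥(maximalRealSubfield L)) L (IsCMField.complexConj L) 3 ((StdForm.antidiagonal 3).over L) ((quasiSplit (↥(maximalRealSubfield L)) L (IsCMField.complexConj L) 3).toAdelic (weylLongU ((IsCMField.complexConj L : L ≃ₐ[↥(maximalRealSubfield L)] L) : L →+* L) (rfl : (StdForm.antidiagonal 3).over L = (StdForm.antidiagonal 3).over L)) * (((heisChart hc (((((0 : InfiniteAdeleRing L)), Xf) : AdeleRing (𝓞 L) L), traceZeroLine ↥(maximalRealSubfield L) L (IsCMField.complexConj L) hcδ hδ ((0, sf) : AdeleRing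 (𝓞 ↥(maximalRealSubfield L)) ↥(maximalRealSubfield L)))) : ↥(adelicUnipotent ↥(maximalRealSubfield L) L (IsCMField.complexConj L) 3)) : (quasiSplit (↥(maximalRealSubfield L)) L (IsCMField.complexConj L) 3).Adelic)) * b₁))
    hΩ _ (hT z hz) (fun X s => by
      rw [flatSectionU_archFin_bigCell_mul_finAdelicToAdelic L hc hcδ hδ (archSectionShifted L (ξ.bcη⁻¹ * ξ.bcψ⁻¹ * μω) ξ.ψ p q) Φf z hb₁ X s,
        archSectionShifted_midBlock_bigCell_eq_prod L hcδ hδ hc ξ hμ p q X s]) (hfin z hz) (hin z hz) (hsp z hz)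
  rw [h𝓕1, ENNReal.toReal_one, inv_one, one_smul] at k
  rw [Finset.prod_congr rfl hω'] at k
  simp only [hqq] at k
  rw [middleCoefficient_basePoint_eq_integral L ν h𝓕 h𝓕c h𝓕1 ξ.hψ hΦ hΦc hΦM Ec hEis hb₁ hz]
  refine k.trans ?_
  ring


/-! ## §3 (ED. 2) The same row with `hT`, `hfin`, `hΦc`, `hΦM` DISCHARGED — ★ Godement majorant `integrable_flatSectionU_weylLongU_mul` (K2E1ChiIntertwinedCoeffKMaxCMThree), ★ F0P2-p11 (g4)
`integrable_finiteWitness_of_height_integrable` (p864772) over ★ `integrable_borelHeight_weylLongU_mul_rpow_cm_three` + ★ Iwasawa, ★ `continuous_archSectionShifted`, ★ `norm_archSectionE_le_one` -/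

/-- **The finite reading `(X_f, s_f) ↦ Φ_f((ι(w₀)·u((0,X_f), θ(0,s_f)))_f·b₁)` is continuous** for continuous `Φ_f` (the Heisenberg chart, `θ`, `(·)_f` and multiplication are continuous).
[cite: Rogawski1990, §1.10] [cite: BorelJacquet1979, §4.1] -/
theorem continuous_finReading (Φf : ↥(finAdelic (↥(maximalRealSubfield L)) L (IsCMField.complexConj L) 3 ((StdForm.antidiagonal 3).over L)) → ℂ) (hΦfc : Continuous Φf) (b₁ : ↥(finAdelic (↥(maximalRealSubfield L)) L (IsCMField.complexConj L) 3 ((StdForm.antidiagonal 3).over L))) :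
    Continuous fun q : FiniteAdeleRing (𝓞 L) L × FiniteAdeleRing (𝓞 ↥(maximalRealSubfield L)) ↥(maximalRealSubfield L) =>
      Φf (finPart (↥(maximalRealSubfield L)) L (IsCMField.complexConj L) 3 ((StdForm.antidiagonal 3).over L) ((quasiSplit (↥(maximalRealSubfield L)) L (IsCMField.complexConj L) 3).toAdelic (weylLongU ((IsCMField.complexConj L : L ≃ₐ[↥(maximalRealSubfield L)] L) : L →+* L) (rfl : (StdForm.antidiagonal 3).over L = (StdForm.antidiagonal 3).over L)) * (((heisChart hc (((((0 : InfiniteAdeleRing L)), q.1) : AdeleRing (𝓞 L) L), traceZeroLine ↥(maximalRealSubfield L) L (IsCMField.complexConj L) hcδ hδ ((0, q.2) : AdeleRing (𝓞 ↥(maximalRealSubfield L)) ↥(maximalRealSubfield L)))) : ↥(adelicUnipotent ↥(maximalRealSubfield L) L (IsCMField.complexConj L) 3)) : (quasiSplit (↥(maximalRealSubfield L)) L (IsCMField.complexConj L) 3).Adelic)) * b₁) := by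
  have hι : Continuous fun q : FiniteAdeleRing (𝓞 L) L × FiniteAdeleRing (𝓞 ↥(maximalRealSubfield L)) ↥(maximalRealSubfield L) =>
      ((((((0 : InfiniteAdeleRing L)), q.1) : AdeleRing (𝓞 L) L)),
        traceZeroLine ↥(maximalRealSubfield L) L (IsCMField.complexConj L) hcδ hδ ((0, q.2) : AdeleRing (𝓞 ↥(maximalRealSubfield L)) ↥(maximalRealSubfield L))) :=
    (continuous_const.prodMk continuous_fst).prodMk ((traceZeroLine ↥(maximalRealSubfield L) L (IsCMField.complexConj L) hcδ hδ).continuous.comp (continuous_const.prodMk continuous_snd))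
  exact hΦfc.comp (((continuous_finPart _ _ _ _ _).comp (continuous_const.mul (continuous_subtype_val.comp ((heisChart hc).continuous.comp hι)))).mul continuous_const)

include hc in
/-- **HEAD (ED. 2) — `hsrc` OF RECORD AT THE MOVED BASE POINT, OF THE CORE LETTERS ONLY.**  §2's head with `hT` := ★ `integrable_flatSectionU_weylLongU_mul` (Godement majorant, `2 < Re z`),
`hfin` := ★ F0P2-p11 `integrable_finiteWitness_of_height_integrable` (Godement letter := ★ `integrable_borelHeight_weylLongU_mul_rpow_cm_three` at `g = 1`, Iwasawa := ★
`exists_mem_borelAdelic_mul_mem_standardMaximalCompactGL_cm_three`, weight measurable := ★ `aestronglyMeasurable_weight_of_continuous` ∘ `continuous_finReading`), `hΦc` := ★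
`continuous_archSectionShifted` × `hΦfc`, `hΦM` := ★ `norm_archSectionShifted_le` + ★ `norm_archSectionE_le_one` (`χ₁ = ξ.bcη⁻¹·ξ.bcψ⁻¹·μω` unitary from `hφ` + ★ `unit_η`, `unit_ψ`) × `hΦfM`.
VISIBLE LETTERS NOW: `hφ hψ hres` (★ by name), `hΦfc hΦfM` (the finite witness is continuous and bounded), `hΦ` (pair-section law), `hEis`, `hgood`, `hωc hω1 hωS₀`, `hΩ` (THE L CORE), tokens `hin hsp`.
[cite: MoeglinWaldspurger1995, II.1.6–II.1.7, IV.1.11] [cite: Godement1964, §1.1] [cite: Rogawski1990, §13.9 p. 229] -/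
theorem hsrc_of_record_at_basePoint_of_core {d : ↥(maximalRealSubfield L)} (hd : δ * δ = algebraMap ↥(maximalRealSubfield L) L d)
    [MeasurableSpace (quasiSplit (↥(maximalRealSubfield L)) L (IsCMField.complexConj L) 3).Adelic] [BorelSpace (quasiSplit (↥(maximalRealSubfield L)) L (IsCMField.complexConj L) 3).Adelic]
    [MeasurableSpace (AdeleRing (𝓞 L) L)] [BorelSpace (AdeleRing (𝓞 L) L)]
    [MeasurableSpace (AdeleRing (𝓞 ↥(maximalRealSubfield L)) ↥(maximalRealSubfield L))] [BorelSpace (AdeleRing (𝓞 ↥(maximalRealSubfield L)) ↥(maximalRealSubfield L))]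
    [MeasurableSpace (InfiniteAdeleRing L)] [BorelSpace (InfiniteAdeleRing L)]
    [MeasurableSpace (InfiniteAdeleRing ↥(maximalRealSubfield L))] [BorelSpace (InfiniteAdeleRing ↥(maximalRealSubfield L))]
    [MeasurableSpace (FiniteAdeleRing (𝓞 L) L)] [BorelSpace (FiniteAdeleRing (𝓞 L) L)]
    [MeasurableSpace (FiniteAdeleRing (𝓞 ↥(maximalRealSubfield L)) ↥(maximalRealSubfield L))] [BorelSpace (FiniteAdeleRing (𝓞 ↥(maximalRealSubfield L)) ↥(maximalRealSubfield L))]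
    [∀ v : HeightOneSpectrum (𝓞 ↥(maximalRealSubfield L)), MeasurableSpace (v.adicCompletion ↥(maximalRealSubfield L))] [∀ v : HeightOneSpectrum (𝓞 ↥(maximalRealSubfield L)), BorelSpace (v.adicCompletion ↥(maximalRealSubfield L))]
    (ν : Measure ↥(adelicUnipotent ↥(maximalRealSubfield L) L (IsCMField.complexConj L) 3)) [ν.IsHaarMeasure]
    {𝓕 : Set ↥(adelicUnipotent ↥(maximalRealSubfield L) L (IsCMField.complexConj L) 3)} (h𝓕 : IsFundamentalDomain ↥(rationalUnipotent ↥(maximalRealSubfield L) L (IsCMField.complexConj L) 3) 𝓕 ν)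
    (μE : Measure (AdeleRing (𝓞 L) L)) [μE.IsAddHaarMeasure] (μE₁ : Measure (InfiniteAdeleRing L)) [μE₁.IsAddHaarMeasure]
    (μE₂ : Measure (FiniteAdeleRing (𝓞 L) L)) [μE₂.IsAddHaarMeasure]
    (μF : Measure (AdeleRing (𝓞 ↥(maximalRealSubfield L)) ↥(maximalRealSubfield L))) [μF.IsAddHaarMeasure] (μF₁ : Measure (InfiniteAdeleRing ↥(maximalRealSubfield L))) [μF₁.IsAddHaarMeasure]
    (μF₂ : Measure (FiniteAdeleRing (𝓞 ↥(maximalRealSubfield L)) ↥(maximalRealSubfield L))) [μF₂.IsAddHaarMeasure]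
    (νv : ∀ v : HeightOneSpectrum (𝓞 ↥(maximalRealSubfield L)), Measure (v.adicCompletion ↥(maximalRealSubfield L))) [∀ v, (νv v).IsAddHaarMeasure]
    (h𝓕c : IsCompact (closure 𝓕)) (h𝓕1 : ν 𝓕 = 1)
    -- the block of record `(ξ, μω)` of unitary type `(kμ, 0)`, the (a-2b) character tokens (★ by name: `isUnitary_bcηInv_mul`, §1), the shifts `(p, q)`
    (ξ : OneDimAutRepH L) {μω : HeckeCharacter L} {kμ : InfinitePlace L → ℤ} (hμ : μω.HasUnitaryArchType kμ 0)
    (hφ : (ξ.bcη⁻¹ * μω).IsUnitary) (hψ : (quadraticHeckeCharCM L * quadraticHeckeCharCM L).IsUnitary)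
    (hres : ∀ x : ideleGroup ↥(maximalRealSubfield L), (ξ.bcη⁻¹ * μω) (AdeleRing.ideleBaseChange (↥(maximalRealSubfield L)) L x) = quadraticHeckeCharCM L x)
    (p q : InfinitePlace L → ℕ) (Φf : ↥(finAdelic (↥(maximalRealSubfield L)) L (IsCMField.complexConj L) 3 ((StdForm.antidiagonal 3).over L)) → ℂ)
    (hΦfc : Continuous Φf) {Mf : ℝ} (hΦfM : ∀ u, ‖Φf u‖ ≤ Mf)
    (hΦ : IsChiSectionPair (ξ.bcη⁻¹ * ξ.bcψ⁻¹ * μω) ξ.ψ (fun g : (quasiSplit (↥(maximalRealSubfield L)) L (IsCMField.complexConj L) 3).Adelic => archSectionShifted L (ξ.bcη⁻¹ * ξ.bcψ⁻¹ * μω) ξ.ψ p q (archPart (↥(maximalRealSubfield L)) L (IsCMField.complexConj L) 3 ((StdForm.antidiagonal 3).over L) g) * Φf (finPart (↥(maximalRealSubfield L)) L (IsCMField.complexConj L) 3 ((StdForm.antidiagonal 3).over L) g)))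
    (Ec : ℂ → (quasiSplit (↥(maximalRealSubfield L)) L (IsCMField.complexConj L) 3).Adelic → ℂ) (hEis : ∀ z : ℂ, 2 < z.re → Ec z = eisensteinSeriesU (flatSectionU (fun g : (quasiSplit (↥(maximalRealSubfield L)) L (IsCMField.complexConj L) 3).Adelic => archSectionShifted L (ξ.bcη⁻¹ * ξ.bcψ⁻¹ * μω) ξ.ψ p q (archPart (↥(maximalRealSubfield L)) L (IsCMField.complexConj L) 3 ((StdForm.antidiagonal 3).over L) g) * Φf (finPart (↥(maximalRealSubfield L)) L (IsCMField.complexConj L) 3 ((StdForm.antidiagonal 3).over L) g)) z))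
    {b₁ : ↥(finAdelic (↥(maximalRealSubfield L)) L (IsCMField.complexConj L) 3 ((StdForm.antidiagonal 3).over L))} (hb₁ : finAdelicToAdelic (↥(maximalRealSubfield L)) L (IsCMField.complexConj L) 3 ((StdForm.antidiagonal 3).over L) b₁ ∈ ((standardMaximalCompactGL 3 L).comap (adelicVal (↥(maximalRealSubfield L)) L (IsCMField.complexConj L) 3 ((StdForm.antidiagonal 3).over L)) : Subgroup (quasiSplit (↥(maximalRealSubfield L)) L (IsCMField.complexConj L) 3).Adelic))
    (S₀ : Finset (HeightOneSpectrum (𝓞 ↥(maximalRealSubfield L))))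
    (hgood : ∀ v ∉ S₀, (Algebra.IsUnramifiedIn (𝓞 L) v.asIdeal ∧ Valued.v (2 : v.adicCompletion ↥(maximalRealSubfield L)) = 1 ∧
        ∀ w : PlacesOver L v, Valued.v (algebraMap L (LocalRing L v) δ w) = 1) ∧ ∀ w : PlacesOver L v, (ξ.bcη⁻¹ * μω).IsUnramifiedAt w.1)
    (𝔫 : Ideal (𝓞 L))
    (ω : ∀ v : HeightOneSpectrum (𝓞 ↥(maximalRealSubfield L)), (Fin 3 → v.adicCompletion ↥(maximalRealSubfield L)) → ℂ)
    (hωc : ∀ z : ℂ, 2 < z.re → ∀ v, Continuous fun p : Fin 3 → v.adicCompletion ↥(maximalRealSubfield L) =>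
        ω v p * (((∏ w' : PlacesOver L v, max 1 (max ((normAbs (w'.1.adicCompletion L) (quadraticLocalEquiv L v (IsCMField.complexConj L) hcδ hδ (p 0, p 1) w') : ℝ≥0) : ℝ)
            ((normAbs (w'.1.adicCompletion L) ((toLocalRing L v (p 2) * algebraMap L (LocalRing L v) δ -
              toLocalRing L v 2⁻¹ * (quadraticLocalEquiv L v (IsCMField.complexConj L) hcδ hδ (p 0, p 1) *
                conjLocal L (IsCMField.complexConj L) v (quadraticLocalEquiv L v (IsCMField.complexConj L) hcδ hδ (p 0, p 1)))) w') : ℝ≥0) : ℝ))) : ℝ) : ℂ) ^ (-z))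
    (hω1 : ∀ v ∉ S₀, ∀ p ∈ integralBox ↥(maximalRealSubfield L) (Fin 3) v, ω v p = 1)
    (hωS₀ : ∀ v ∈ S₀, ω v = Set.indicator {p : Fin 3 → v.adicCompletion ↥(maximalRealSubfield L) | p ∈ integralBox ↥(maximalRealSubfield L) (Fin 3) v ∧ ∀ w' : PlacesOver L v,
              Valued.v (quadraticLocalEquiv L v (IsCMField.complexConj L) hcδ hδ (p 0, p 1) w') ≤ idealRadius L w'.1 𝔫 ∧
              Valued.v (conjLocal L (IsCMField.complexConj L) v (quadraticLocalEquiv L v (IsCMField.complexConj L) hcδ hδ (p 0, p 1)) w') ≤ idealRadius L w'.1 𝔫 ∧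
              Valued.v ((toLocalRing L v (p 2) * algebraMap L (LocalRing L v) δ -
                toLocalRing L v 2⁻¹ * (quadraticLocalEquiv L v (IsCMField.complexConj L) hcδ hδ (p 0, p 1) * conjLocal L (IsCMField.complexConj L) v (quadraticLocalEquiv L v (IsCMField.complexConj L) hcδ hδ (p 0, p 1)))) w') ≤ idealRadius L w'.1 𝔫}
            (fun _ => (1 : ℂ)))
    (hΩ : ∀ x : Fin 3 → FiniteAdeleRing (𝓞 ↥(maximalRealSubfield L)) ↥(maximalRealSubfield L),
      Φf (finPart (↥(maximalRealSubfield L)) L (IsCMField.complexConj L) 3 ((StdForm.antidiagonal 3).over L) ((quasiSplit (↥(maximalRealSubfield L)) L (IsCMField.complexConj L) 3).toAdelic (weylLongU ((IsCMField.complexConj L : L ≃ₐ[↥(maximalRealSubfield L)] L) : L →+* L) (rfl : (StdForm.antidiagonal 3).over L = (StdForm.antidiagonal 3).over L)) * (((heisChart hc (((((0 : InfiniteAdeleRing L)), quadraticFiniteAdeleMap ↥(maximalRealSubfield L) L δ (x 0, x 1)) : AdeleRing (𝓞 L) L), traceZeroLine ↥(maximalRealSubfield L) L (IsCMField.complexConj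 L) hcδ hδ ((0, x 2) : AdeleRing (𝓞 ↥(maximalRealSubfield L)) ↥(maximalRealSubfield L)))) : ↥(adelicUnipotent ↥(maximalRealSubfield L) L (IsCMField.complexConj L) 3)) : (quasiSplit (↥(maximalRealSubfield L)) L (IsCMField.complexConj L) 3).Adelic)) * b₁) = ∏ᶠ v : HeightOneSpectrum (𝓞 ↥(maximalRealSubfield L)), ω v (fun i => x i v))
    (hin : ∀ z : ℂ, 2 < z.re → ∀ v ∉ S₀, ∀ w : PlacesOver L v, IsCMField.complexConj L • w.1 = w.1 →
        ((Measure.pi fun _ : Fin 3 => νv v) (integralBox ↥(maximalRealSubfield L) (Fin 3) v)).toReal⁻¹ •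
            ∫ p : Fin 3 → v.adicCompletion ↥(maximalRealSubfield L),
              ω v p * (((∏ w' : PlacesOver L v, max 1 (max ((normAbs (w'.1.adicCompletion L) (quadraticLocalEquiv L v (IsCMField.complexConj L) hcδ hδ (p 0, p 1) w') : ℝ≥0) : ℝ)
                ((normAbs (w'.1.adicCompletion L) ((toLocalRing L v (p 2) * algebraMap L (LocalRing L v) δ -
                  toLocalRing L v 2⁻¹ * (quadraticLocalEquiv L v (IsCMField.complexConj L) hcδ hδ (p 0, p 1) *
                    conjLocal L (IsCMField.complexConj L) v (quadraticLocalEquiv L v (IsCMField.complexConj L) hcδ hδ (p 0, p 1)))) w') : ℝ≥0) : ℝ))) : ℝ) : ℂ) ^ (-z)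
              ∂(Measure.pi fun _ : Fin 3 => νv v) =
          (1 - (ξ.bcη⁻¹ * μω).valueAtUniformizer w.1 * (v.residueCard : ℂ) ^ (-(2 * z))) * (1 + (ξ.bcη⁻¹ * μω).valueAtUniformizer w.1 * (v.residueCard : ℂ) ^ (-(2 * z - 1))) /
            ((1 - (ξ.bcη⁻¹ * μω).valueAtUniformizer w.1 * (v.residueCard : ℂ) ^ (-(2 * z - 2))) * (1 + (ξ.bcη⁻¹ * μω).valueAtUniformizer w.1 * (v.residueCard : ℂ) ^ (-(2 * z - 2)))))
    (hsp : ∀ z : ℂ, 2 < z.re → ∀ v ∉ S₀, ∀ w : PlacesOver L v, IsCMField.complexConj L • w.1 ≠ w.1 →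
        ((Measure.pi fun _ : Fin 3 => νv v) (integralBox ↥(maximalRealSubfield L) (Fin 3) v)).toReal⁻¹ •
            ∫ p : Fin 3 → v.adicCompletion ↥(maximalRealSubfield L),
              ω v p * (((∏ w' : PlacesOver L v, max 1 (max ((normAbs (w'.1.adicCompletion L) (quadraticLocalEquiv L v (IsCMField.complexConj L) hcδ hδ (p 0, p 1) w') : ℝ≥0) : ℝ)
                ((normAbs (w'.1.adicCompletion L) ((toLocalRing L v (p 2) * algebraMap L (LocalRing L v) δ -
                  toLocalRing L v 2⁻¹ * (quadraticLocalEquiv L v (IsCMField.complexConj L) hcδ hδ (p 0, p 1) *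
                    conjLocal L (IsCMField.complexConj L) v (quadraticLocalEquiv L v (IsCMField.complexConj L) hcδ hδ (p 0, p 1)))) w') : ℝ≥0) : ℝ))) : ℝ) : ℂ) ^ (-z)
              ∂(Measure.pi fun _ : Fin 3 => νv v) =
          (1 - (ξ.bcη⁻¹ * μω).valueAtUniformizer w.1 * (v.residueCard : ℂ) ^ (-z)) * (1 - (ξ.bcη⁻¹ * μω).valueAtUniformizer (PlacesOver.galInv (IsCMField.complexConj L) w).1 * (v.residueCard : ℂ) ^ (-z)) *
              (1 - (ξ.bcη⁻¹ * μω).valueAtUniformizer w.1 * (ξ.bcη⁻¹ * μω).valueAtUniformizer (PlacesOver.galInv (IsCMField.complexConj L) w).1 * (v.residueCard : ℂ) ^ (-(2 * z - 1))) /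
            ((1 - (ξ.bcη⁻¹ * μω).valueAtUniformizer w.1 * (v.residueCard : ℂ) ^ (-(z - 1))) * (1 - (ξ.bcη⁻¹ * μω).valueAtUniformizer (PlacesOver.galInv (IsCMField.complexConj L) w).1 * (v.residueCard : ℂ) ^ (-(z - 1))) *
              (1 - (ξ.bcη⁻¹ * μω).valueAtUniformizer w.1 * (ξ.bcη⁻¹ * μω).valueAtUniformizer (PlacesOver.galInv (IsCMField.complexConj L) w).1 * (v.residueCard : ℂ) ^ (-(2 * z - 2))))) :
    ∀ z : ℂ, 2 < z.re →
      (borelConstantTerm ν 𝓕 (Ec z) (finAdelicToAdelic (↥(maximalRealSubfield L)) L (IsCMField.complexConj L) 3 ((StdForm.antidiagonal 3).over L) b₁) - archSectionShifted L (ξ.bcη⁻¹ * ξ.bcψ⁻¹ * μω) ξ.ψ p q (archPart (↥(maximalRealSubfield L)) L (IsCMField.complexConj L) 3 ((StdForm.antidiagonal 3).over L) (finAdelicToAdelic (↥(maximalRealSubfield L)) L (IsCMField.complexConj L) 3 ((StdForm.antidiagonal 3).over L) b₁)) * Φf (finPart (↥(maximalRealSubfield L)) L (IsCMField.complexConj L)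 3 ((StdForm.antidiagonal 3).over L) (finAdelicToAdelic (↥(maximalRealSubfield L)) L (IsCMField.complexConj L) 3 ((StdForm.antidiagonal 3).over L) b₁)) * (((borelHeight (finAdelicToAdelic (↥(maximalRealSubfield L)) L (IsCMField.complexConj L) 3 ((StdForm.antidiagonal 3).over L) b₁) : ℝ≥0) : ℝ) : ℂ) ^ z) / (((borelHeight (finAdelicToAdelic (↥(maximalRealSubfield L)) L (IsCMField.complexConj L) 3 ((StdForm.antidiagonal 3).over L) b₁) : ℝ≥0) : ℝ) : ℂ) ^ (2 - z) =
        (((unfoldingHaarConst L hc hcδ hδ hd ν h𝓕 μE μE₁ μE₂ μF μF₁ μF₂ νv hφ hψ hres : ℝ) : ℂ) * ∏ v ∈ S₀, ((Measure.pi fun _ : Fin 3 => νv v) (integralBox ↥(maximalRealSubfield L) (Fin 3) v)).toReal⁻¹ •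
        ∫ p : Fin 3 → v.adicCompletion ↥(maximalRealSubfield L),
                    Set.indicator {p : Fin 3 → v.adicCompletion ↥(maximalRealSubfield L) | p ∈ integralBox ↥(maximalRealSubfield L) (Fin 3) v ∧ ∀ w' : PlacesOver L v,
              Valued.v (quadraticLocalEquiv L v (IsCMField.complexConj L) hcδ hδ (p 0, p 1) w') ≤ idealRadius L w'.1 𝔫 ∧
              Valued.v (conjLocal L (IsCMField.complexConj L) v (quadraticLocalEquiv L v (IsCMField.complexConj L) hcδ hδ (p 0, p 1)) w') ≤ idealRadius L w'.1 𝔫 ∧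
              Valued.v ((toLocalRing L v (p 2) * algebraMap L (LocalRing L v) δ -
                toLocalRing L v 2⁻¹ * (quadraticLocalEquiv L v (IsCMField.complexConj L) hcδ hδ (p 0, p 1) * conjLocal L (IsCMField.complexConj L) v (quadraticLocalEquiv L v (IsCMField.complexConj L) hcδ hδ (p 0, p 1)))) w') ≤ idealRadius L w'.1 𝔫}
            (fun _ => (1 : ℂ)) p *
          (((∏ w' : PlacesOver L v, max 1 (max ((normAbs (w'.1.adicCompletion L) (quadraticLocalEquiv L v (IsCMField.complexConj L) hcδ hδ (p 0, p 1) w') : ℝ≥0) : ℝ)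
            ((normAbs (w'.1.adicCompletion L) ((toLocalRing L v (p 2) * algebraMap L (LocalRing L v) δ -
              toLocalRing L v 2⁻¹ * (quadraticLocalEquiv L v (IsCMField.complexConj L) hcδ hδ (p 0, p 1) *
                conjLocal L (IsCMField.complexConj L) v (quadraticLocalEquiv L v (IsCMField.complexConj L) hcδ hδ (p 0, p 1)))) w') : ℝ≥0) : ℝ))) : ℝ) : ℂ) ^ (-z) ∂(Measure.pi fun _ : Fin 3 => νv v)) *
      (∫ Xi : InfiniteAdeleRing L, ∫ a : InfiniteAdeleRing ↥(maximalRealSubfield L),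
      (∏ w : InfinitePlace L, unfoldingArchPhase L ξ w * archUnitaryValue (kμ w - 2 * ξ.eη w) 0 ((((-(1 + ‖Xi w‖ ^ 2 / 2)) : ℝ) : ℂ) + (((w.embedding δ).im * ((InfiniteAdeleRing.ringEquiv_mixedSpace ↥(maximalRealSubfield L)) a).1 ⟨w.comap (algebraMap ↥(maximalRealSubfield L) L), K2E1HeightBigCellLineFormulaU2.isReal_comap_maximalRealSubfield L w⟩ : ℝ) : ℂ) * Complex.I) * (((2 : ℂ) + ((((-(1 + ‖Xi w‖ ^ 2 / 2)) : ℝ) : ℂ) + (((w.embedding δ).im * ((InfiniteAdeleRing.ringEquiv_mixedSpace ↥(maximalRealSubfield L)) a).1 ⟨w.comap (algebraMap ↥(maximalRealSubfield L) L), K2E1HeightBigCellLineFormulaU2.isReal_comap_maximalRealSubfield L w⟩ : ℝ) : ℂ) * Complex.I)) / ((((-(1 + ‖Xi w‖ ^ 2 / 2)) : ℝ) : ℂ) + (((w.embedding δ).im * ((InfiniteAdeleRing.ringEquiv_mixedSpace ↥(maximalRealSubfield L)) a).1 ⟨w.comap (algebraMap ↥(maximalRealSubfield L) L), K2E1HeightBigCellLineFormulaU2.isReal_comap_maximalRealSubfield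 L w⟩ : ℝ) : ℂ) * Complex.I)) ^ p w * (((2 : ℂ) + conj ((((-(1 + ‖Xi w‖ ^ 2 / 2)) : ℝ) : ℂ) + (((w.embedding δ).im * ((InfiniteAdeleRing.ringEquiv_mixedSpace ↥(maximalRealSubfield L)) a).1 ⟨w.comap (algebraMap ↥(maximalRealSubfield L) L), K2E1HeightBigCellLineFormulaU2.isReal_comap_maximalRealSubfield L w⟩ : ℝ) : ℂ) * Complex.I)) / conj ((((-(1 + ‖Xi w‖ ^ 2 / 2)) : ℝ) : ℂ) + (((w.embedding δ).im * ((InfiniteAdeleRing.ringEquiv_mixedSpace ↥(maximalRealSubfield L)) a).1 ⟨w.comap (algebraMap ↥(maximalRealSubfield L) L), K2E1HeightBigCellLineFormulaU2.isReal_comap_maximalRealSubfield L w⟩ : ℝ) : ℂ) * Complex.I)) ^ q w) *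
        ((((∏ w : InfinitePlace L, ((1 + ‖(Xi) w‖ ^ 2 / 2) ^ 2 + (w δ) ^ 2 * (((InfiniteAdeleRing.ringEquiv_mixedSpace ↥(maximalRealSubfield L)) a).1 ⟨w.comap (algebraMap ↥(maximalRealSubfield L) L), K2E1HeightBigCellLineFormulaU2.isReal_comap_maximalRealSubfield L w⟩) ^ 2))) : ℝ) : ℂ) ^ (-z) ∂μF₁ ∂μE₁) *
        ((partialStandardL {w : HeightOneSpectrum (𝓞 L) | w.under (𝓞 ↥(maximalRealSubfield L)) ∈ (↑S₀ : Set (HeightOneSpectrum (𝓞 ↥(maximalRealSubfield L))))} (fun w => {(ξ.bcη⁻¹ * μω).valueAtUniformizer w}) (z - 1) *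
            partialStandardL (↑S₀ : Set (HeightOneSpectrum (𝓞 ↥(maximalRealSubfield L)))) (fun v => {(1 : HeckeCharacter ↥(maximalRealSubfield L)).valueAtUniformizer v}) (2 * z - 2)) /
          (partialStandardL {w : HeightOneSpectrum (𝓞 L) | w.under (𝓞 ↥(maximalRealSubfield L)) ∈ (↑S₀ : Set (HeightOneSpectrum (𝓞 ↥(maximalRealSubfield L))))} (fun w => {(ξ.bcη⁻¹ * μω).valueAtUniformizer w}) z *
            partialStandardL (↑S₀ : Set (HeightOneSpectrum (𝓞 ↥(maximalRealSubfield L)))) (fun v => {(1 : HeckeCharacter ↥(maximalRealSubfield L)).valueAtUniformizer v}) (2 * z - 1)))  := by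
  have hη1 : ∀ x : ideleGroup L, ‖((ξ.bcη x : ℂˣ) : ℂ)‖ = 1 := fun x => by rw [OneDimAutRepH.bcη_apply]; exact ξ.unit_η _
  have hψ1 : ∀ x : ideleGroup L, ‖((ξ.bcψ x : ℂˣ) : ℂ)‖ = 1 := fun x => by rw [OneDimAutRepH.bcψ_apply]; exact ξ.unit_ψ _
  have hμu : μω.IsUnitary := fun x => by
    have h2 := hφ x
    rwa [HeckeCharacter.mul_apply, HeckeCharacter.inv_apply, Units.val_mul, norm_mul, Units.val_inv_eq_inv_val, norm_inv, hη1, inv_one, one_mul] at h2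
  have hχ₁u : (ξ.bcη⁻¹ * ξ.bcψ⁻¹ * μω).IsUnitary := fun x => by
    rw [HeckeCharacter.mul_apply, HeckeCharacter.mul_apply, HeckeCharacter.inv_apply, HeckeCharacter.inv_apply, Units.val_mul, Units.val_mul, norm_mul, norm_mul,
      Units.val_inv_eq_inv_val, Units.val_inv_eq_inv_val, norm_inv, norm_inv, hη1, hψ1, hμu x, inv_one, one_mul, one_mul]
  have hΦc : Continuous (fun g : (quasiSplit (↥(maximalRealSubfield L)) L (IsCMField.complexConj L) 3).Adelic => archSectionShifted L (ξ.bcη⁻¹ * ξ.bcψ⁻¹ * μω) ξ.ψ p q (archPart (↥(maximalRealSubfield L)) L (IsCMField.complexConj L) 3 ((StdForm.antidiagonal 3).over L) g) * Φf (finPart (↥(maximalRealSubfield L)) L (IsCMField.complexConj L) 3 ((StdForm.antidiagonal 3).over L) g)) :=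
    ((continuous_archSectionShifted L _ _ p q).comp (continuous_archPart _ _ _ _ _)).mul (hΦfc.comp (continuous_finPart _ _ _ _ _))
  have hΦM : ∀ x : (quasiSplit (↥(maximalRealSubfield L)) L (IsCMField.complexConj L) 3).Adelic, ‖archSectionShifted L (ξ.bcη⁻¹ * ξ.bcψ⁻¹ * μω) ξ.ψ p q (archPart (↥(maximalRealSubfield L)) L (IsCMField.complexConj L) 3 ((StdForm.antidiagonal 3).over L) x) * Φf (finPart (↥(maximalRealSubfield L)) L (IsCMField.complexConj L) 3 ((StdForm.antidiagonal 3).over L) x)‖ ≤ Mf := fun x => by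
    rw [norm_mul]
    exact (mul_le_of_le_one_left (norm_nonneg _) ((norm_archSectionShifted_le L _ _ p q _).trans (norm_archSectionE_le_one L _ _ hχ₁u (ξ.unit_ψ) _))).trans (hΦfM _)
  haveI : ν.IsInvInvariant := isInvInvariant_of_isHaarMeasure_adelicUnipotent_three (AlgEquiv.ext fun x => IsCMField.complexConj_apply_apply L x) ν
  refine hsrc_of_record_at_basePoint L hc hcδ hδ hd ν h𝓕 μE μE₁ μE₂ μF μF₁ μF₂ νv h𝓕c h𝓕1 ξ hμ hφ hψ hres p q Φf hΦ hΦc hΦM Ec hEis hb₁ S₀ hgood 𝔫 ω hωc hω1 hωS₀ hΩ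
    (fun z hz => integrable_flatSectionU_weylLongU_mul L ν h𝓕 h𝓕c hΦc hΦM hz _) (fun z hz => ?_) hin hsp
  have h1 := integrable_borelHeight_weylLongU_mul_rpow_cm_three L ν h𝓕 h𝓕c hz (1 : (quasiSplit (↥(maximalRealSubfield L)) L (IsCMField.complexConj L) 3).Adelic)
  simp only [mul_one] at h1
  exact integrable_finiteWitness_of_height_integrable L hc hcδ hδ (IsCMField.complexConj_ne_one (K := L)) (exists_mem_borelAdelic_mul_mem_standardMaximalCompactGL_cm_three L)
    ν μE μE₁ μE₂ μF μF₁ μF₂ hz h1.ofReal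
    (fun (Xf : FiniteAdeleRing (𝓞 L) L) (sf : FiniteAdeleRing (𝓞 ↥(maximalRealSubfield L)) ↥(maximalRealSubfield L)) => Φf (finPart (↥(maximalRealSubfield L)) L (IsCMField.complexConj L) 3 ((StdForm.antidiagonal 3).over L) ((quasiSplit (↥(maximalRealSubfield L)) L (IsCMField.complexConj L) 3).toAdelic (weylLongU ((IsCMField.complexConj L : L ≃ₐ[↥(maximalRealSubfield L)] L) : L →+* L) (rfl : (StdForm.antidiagonal 3).over L = (StdForm.antidiagonal 3).over L)) * (((heisChart hc (((((0 : InfiniteAdeleRing L)), Xf) : AdeleRing (𝓞 L) L), traceZeroLine ↥(maximalRealSubfield L) L (IsCMField.complexConj L) hcδ hδ ((0, sf) : AdeleRing (𝓞 ↥(maximalRealSubfield L)) ↥(maximalRealSubfield L)))) : ↥(adelicUnipotent ↥(maximalRealSubfield L) L (IsCMField.complexConj L) 3)) : (quasiSplit (↥(maximalRealSubfield L)) L (IsCMField.complexConj L) 3).Adelic)) * b₁))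
    (aestronglyMeasurable_weight_of_continuous L (μE₂.prod μF₂)
      (fun (Xf : FiniteAdeleRing (𝓞 L) L) (sf : FiniteAdeleRing (𝓞 ↥(maximalRealSubfield L)) ↥(maximalRealSubfield L)) => Φf (finPart (↥(maximalRealSubfield L)) L (IsCMField.complexConj L) 3 ((StdForm.antidiagonal 3).over L) ((quasiSplit (↥(maximalRealSubfield L)) L (IsCMField.complexConj L) 3).toAdelic (weylLongU ((IsCMField.complexConj L : L ≃ₐ[↥(maximalRealSubfield L)] L) : L →+* L) (rfl : (StdForm.antidiagonal 3).over L = (StdForm.antidiagonal 3).over L)) * (((heisChart hc (((((0 : InfiniteAdeleRing L)), Xf) : AdeleRing (𝓞 L) L), traceZeroLine ↥(maximalRealSubfield L) L (IsCMField.complexConj L) hcδ hδ ((0, sf) : AdeleRing (𝓞 ↥(maximalRealSubfield L)) ↥(maximalRealSubfield L)))) : ↥(adelicUnipotent ↥(maximalRealSubfield L) L (IsCMField.complexConj L) 3)) : (quasiSplit (↥(maximalRealSubfield L)) L (IsCMField.complexConj L) 3).Adelic)) * b₁))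
      (continuous_finReading L hc hcδ hδ Φf hΦfc b₁)) (fun _ _ => hΦfM _)

end Summit.HodgeConjecture.HodgeConjecture.Cruxes.H413.K2E1ChiMidBlockUnfoldingOfRecordU3

end
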